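import Literature.NumberTheory.Automorphic.HeckeJPSSIntegralUnfoldedGL2
import Literature.NumberTheory.Automorphic.WhittakerCoeffTransposeInvGL2
import Literature.NumberTheory.Automorphic.CuspidalContragredientForms
import Literature.NumberTheory.Automorphic.HarishChandraFinitenessGLCuspidal
import Literature.NumberTheory.Automorphic.JPSSGlobalFunctionalEquation
import Literature.NumberTheory.Automorphic.CornerTorusIwasawaData
import HarnessLib

/-!
# The DUAL global Hecke integral of a cusp form on `GL₂` unfolded to the ideles:
# `I(s; φ ∘ ι̂, 𝟙) = C ∫_{𝕀_K} W̃_φ(diag(a,1)) |a|^{s-1/2} d×a`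
# (Jacquet–Langlands (1970), Thm. 11.1, proof pp. 230–231; Cogdell (2004), §2.3, Thm. 2.1 for `(n, m) = (2, 1)`)

Topic `NumberTheory/Automorphic`; namespace `Literature.NumberTheory.Automorphic`. Theorems only (no
definition, no named fact, no instance). The dual companion of `HeckeJPSSIntegralUnfoldedGL2`: for a cusp
form `Φ = invQuot φ` on `GL₂(𝔸_K)` the substituted class function `φ ∘ ι̂` (`ι̂ = glTransposeInvQuot`, the
involution `g ↦ ᵗg⁻¹` on `X₂`; `jpssIntegral (φ ∘ ι̂) 𝟙 s = jpssIntegral φ 𝟙 (1 - s)` is the global functional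
equation `jpssIntegral_comp_glTransposeInvQuot` of the tree) has classical function `Φ ∘ ι`
(`invQuot_comp_glTransposeInvQuot`), again a cusp form (`IsCuspFormGL.comp_transposeInv`:
`Φ ∘ ι = (R_w Φ) ∘ τ` with `τ = w ι(·) w`, by left-invariance under the rational `w`), whose Tate-normalised
Whittaker transform at `diag(a, 1)` is `W̃_Φ(diag(-a, 1))` (`whittakerDepth_zero_comp_glTransposeInv_glDiagonal_two`,
`W̃(g) = W(w ᵗg⁻¹)`); the substitution `a ↦ -a` in the Haar integral over `𝕀_K` removes the sign. Hence,
with THE SAME constant `C` as on the direct side: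

* `exists_jpssIntegral_two_one_and_dual_eq_mul_integral_idele` (**main**): there is `C > 0` with, for every
  cusp form `Φ = invQuot φ` and every `s`,

    `jpssIntegral (1<2) μ' φ 𝟙 s = C ∫_{𝕀_K} W_Φ(diag(a,1)) ‖a‖^{s-1/2} d(det_* ν)` and
    `jpssIntegral (1<2) μ' (φ ∘ ι̂) 𝟙 s = C ∫_{𝕀_K} W̃_Φ(diag(a,1)) ‖a‖^{s-1/2} d(det_* ν)`,

  each under the absolute convergence of its right-hand side.

## References

* H. Jacquet, R. P. Langlands, *Automorphic Forms on GL(2)*, LNM 114 (1970), Thm. 11.1, proof pp. 230–231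
  [JacquetLanglands1970].
* J. W. Cogdell, *Lectures on L-functions, converse theorems, and functoriality for GL_n* (2004), §2.3,
  Thm. 2.1 (PDF p. 184) [CogdellAnalyticTheory2004].
-/

noncomputable section

open MeasureTheory Measure NumberField NumberField.mixedEmbedding IsDedekindDomain Matrix Set Filter Topology
open Literature.MeasureTheory.Group
open Literature.NumberTheory.GaloisRepresentations (ideleGroup coe_glTransposeInv_apply)
open scoped MatrixGroups ENNReal NNReal Classical

namespace Literature.NumberTheory.Automorphic

variable {K : Type} [Field K] [NumberField K]

local notation "𝔸" => AdeleRing (𝓞 K) K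

/-! ### 1. `Φ ∘ ι` is a cusp form -/

section Cusp

variable {n : ℕ}

/-- The long Weyl element of `GL_n(K_∞)` lies in `K_∞` (a real permutation matrix is unitary). [folklore] -/
theorem weylLong_mem_Kinf : weylLong n (mixedSpace K) ∈ Kinf n K := by
  rw [Kinf_eq_unitarySubgroupGL, mem_unitarySubgroupGL_iff, Matrix.star_eq_conjTranspose]
  have hentry : ∀ i j : Fin n, ((weylLong n (mixedSpace K) : GL (Fin n) (mixedSpace K)) :
      Matrix (Fin n) (Fin n) (mixedSpace K)) i j = if Fin.rev i = j then 1 else 0 := by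
    intro i j
    rw [coe_weylLong, Equiv.Perm.permMatrix, PEquiv.toMatrix_apply]
    simp only [Equiv.toPEquiv_apply, Fin.revPerm_apply, Option.mem_def, Option.some.injEq]
  have hstar : Matrix.conjTranspose ((weylLong n (mixedSpace K) : GL (Fin n) (mixedSpace K)) :
      Matrix (Fin n) (Fin n) (mixedSpace K)) =
      ((weylLong n (mixedSpace K) : GL (Fin n) (mixedSpace K)) : Matrix (Fin n) (Fin n) (mixedSpace K)) := by
    refine Matrix.ext fun i j => ?_
    rw [Matrix.conjTranspose_apply, hentry, hentry]
    by_cases h : Fin.rev j = i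
    · rw [if_pos h, if_pos (by rw [← h, Fin.rev_rev]), star_one]
    · rw [if_neg h, if_neg (fun h' => h (by rw [← h', Fin.rev_rev])), star_zero]
  rw [hstar, ← Units.val_mul, weylLong_mul_self, Units.val_one]

/-- The archimedean part of the adelic long Weyl element (private copy of the lemma of
`HeckeIntegrandPureTensorDualOnBox`). [folklore] -/
private theorem toMixed_weylLong' : GLn.toMixed n K (weylLong n 𝔸) = weylLong n (mixedSpace K) := by
  refine Matrix.GeneralLinearGroup.ext fun i j => ?_
  rw [GLn.coe_toMixed_apply, coe_weylLong, coe_weylLong, Equiv.Perm.permMatrix, Equiv.Perm.permMatrix,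
    PEquiv.toMatrix_apply, PEquiv.toMatrix_apply]
  split_ifs
  · change InfiniteAdeleRing.ringEquiv_mixedSpace K 1 = 1
    exact map_one _
  · change InfiniteAdeleRing.ringEquiv_mixedSpace K 0 = 0
    exact map_zero _

/-- The finite part of the adelic long Weyl element. [folklore] -/
private theorem sndHom_weylLong' : GLn.sndHom n K (weylLong n 𝔸) = weylLong n (FiniteAdeleRing (𝓞 K) K) :=
  map_weylLong _

/-- **Right translation by the adelic long Weyl element preserves cusp forms** (`w = (w_∞, 1)(1, w_f)` with
`w_∞ ∈ K_∞` and `(1, w_f) ∈ GL_n(𝔸_K^∞)`). [cite: BorelJacquet1979, 4.4] -/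
theorem IsCuspFormGL.rightTranslation_weylLong {hcpt : isCompact_glFiniteIntegralLevel n K}
    {Φ : (AdelicGroupData.gl n K).Adelic → ℂ} (hΦ : IsCuspFormGL n K hcpt Φ) :
    IsCuspFormGL n K hcpt (rightTranslation (AdelicGroupData.gl n K) (weylLong n 𝔸 : GL (Fin n) 𝔸) Φ) := by
  have h1 : IsCuspFormGL n K hcpt (rightTranslation (AdelicGroupData.gl n K)
      (GLn.ofFinite n K (weylLong n (FiniteAdeleRing (𝓞 K) K))) Φ) :=
    hΦ.rightTranslation_gl (by rw [AutomorphyDatum.gl_finiteAdelic]; exact ⟨_, rfl⟩)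
  have h2 := h1.rightTranslation_ofK_gl ⟨weylLong n (mixedSpace K), weylLong_mem_Kinf⟩
  have key : rightTranslation (AdelicGroupData.gl n K) (weylLong n 𝔸 : GL (Fin n) 𝔸) Φ =
      rightTranslation (AdelicGroupData.gl n K)
          ((AutomorphyDatum.gl n K hcpt).ofK ⟨weylLong n (mixedSpace K), weylLong_mem_Kinf⟩)
        (rightTranslation (AdelicGroupData.gl n K) (GLn.ofFinite n K (weylLong n (FiniteAdeleRing (𝓞 K) K))) Φ) := by
    funext g
    simp only [rightTranslation_apply]
    congr 1
    exact (show (show GL (Fin n) 𝔸 from g) * weylLong n 𝔸 =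
        (show GL (Fin n) 𝔸 from g) * GLn.ofInfinite n K (weylLong n (mixedSpace K)) *
          GLn.ofFinite n K (weylLong n (FiniteAdeleRing (𝓞 K) K)) from by
      rw [mul_assoc, ← toMixed_weylLong' (K := K) (n := n), ← sndHom_weylLong',
        GLn.ofInfinite_toMixed_mul_ofFinite_sndHom])
  rw [key]
  exact h2

/-- **`Φ ∘ ι` is a cusp form for every cusp form `Φ`** (`ι g = ᵗg⁻¹`, the tree's `GLn.transposeInv`):
`Φ(ι g) = Φ(w ι(g) w · w) = (R_w Φ)(τ g)` by left-invariance under the rational `w`, and `R_w Φ`,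
`(R_w Φ) ∘ τ` are cusp forms (`IsCuspFormGL.rightTranslation_weylLong`,
`IsCuspFormGL.funLeft_weylLong_mul_glTransposeInv_mul_weylLong`). [cite: BorelJacquet1979, 4.4]
[cite: CogdellAnalyticTheory2004, §2.3] -/
theorem IsCuspFormGL.comp_transposeInv {hcpt : isCompact_glFiniteIntegralLevel n K}
    {Φ : (AdelicGroupData.gl n K).Adelic → ℂ} (hΦ : IsCuspFormGL n K hcpt Φ) :
    IsCuspFormGL n K hcpt (Φ ∘ GLn.transposeInv n K) := by
  have h := (hΦ.rightTranslation_weylLong).funLeft_weylLong_mul_glTransposeInv_mul_weylLong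
  convert h using 1
  funext g
  rw [Function.comp_apply, LinearMap.funLeft_apply, rightTranslation_apply]
  symm
  exact (congrArg Φ (show weylLong n 𝔸 * GaloisRepresentations.glTransposeInv (Fin n) 𝔸 g * weylLong n 𝔸 *
      weylLong n 𝔸 = weylLong n 𝔸 * GaloisRepresentations.glTransposeInv (Fin n) 𝔸 g from by
    rw [mul_assoc, weylLong_mul_self, mul_one])).trans (hΦ.1.leftInvariant _ (weylLong_mem_arithmeticSubgroup n) _)

end Cusp

/-! ### 2. The dual unfolding -/

section Main

attribute [local instance] adelicBorel borelSpace_adelic locallyCompactSpace_adelic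
  secondCountableTopology_gl_adelic glAdeleBorel borelSpace_glAdele

variable [MeasurableSpace (ideleGroup K)] [BorelSpace (ideleGroup K)]

omit [MeasurableSpace (ideleGroup K)] [BorelSpace (ideleGroup K)] in
/-- `‖-a‖ = ‖a‖` on `𝕀_K`. [folklore] -/
theorem ideleNorm_neg (a : ideleGroup K) : IdeleClassGroup.ideleNorm K (-a) = IdeleClassGroup.ideleNorm K a := by
  have h1 : IdeleClassGroup.ideleNorm K (-1 : ideleGroup K) = 1 := by
    have hsq : (IdeleClassGroup.ideleNorm K (-1 : ideleGroup K) : ℝ) ^ 2 = 1 := by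
      rw [sq, ← NNReal.coe_mul, ← map_mul, neg_one_mul, neg_neg, map_one, NNReal.coe_one]
    exact_mod_cast (pow_eq_one_iff_of_nonneg (NNReal.coe_nonneg _) two_ne_zero).1 hsq
  rw [← neg_one_mul, map_mul, h1, one_mul]

/-- **MAIN. The global Hecke integral of a `GL₂` cusp form and of its `ι̂`-substitute, unfolded to the
ideles with one and the same constant.** For an automorphic measure `μ'` on `X₁` and a Haar measure `ν` on
`GL₁(𝔸_K)` there is `C > 0` such that for every `φ` on `X₂` whose classical function `Φ = invQuot φ` is a cusp
form and every `s ∈ ℂ`: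

  `jpssIntegral (1<2) μ' φ 𝟙 s = C · ∫_{𝕀_K} W_Φ(diag(a,1)) ‖a‖^{s-1/2} d(det_* ν)(a)` and
  `jpssIntegral (1<2) μ' (φ ∘ ι̂) 𝟙 s = C · ∫_{𝕀_K} W̃_Φ(diag(a,1)) ‖a‖^{s-1/2} d(det_* ν)(a)`,

each whenever its right-hand side converges absolutely (`W = whittakerDepth 0 Φ`, `W̃ = tildeFn W`).
[cite: JacquetLanglands1970, Thm. 11.1, proof pp. 230–231] [cite: CogdellAnalyticTheory2004, §2.3 Thm. 2.1] -/
theorem exists_jpssIntegral_two_one_and_dual_eq_mul_integral_idele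
    (μ' : Measure (AdelicGroupData.gl 1 K).automorphicQuotient) [(AdelicGroupData.gl 1 K).IsAutomorphicMeasure μ']
    (ν : Measure (GL (Fin 1) 𝔸)) [ν.IsHaarMeasure] :
    ∃ C : ℝ, 0 < C ∧
      ∀ {hcpt : isCompact_glFiniteIntegralLevel 2 K} (φ : (AdelicGroupData.gl 2 K).automorphicQuotient → ℂ),
        IsCuspFormGL 2 K hcpt (invQuot (AdelicGroupData.gl 2 K) φ) →
      ∀ s : ℂ,
        (∫⁻ a, ‖whittakerDepth 0 (invQuot (AdelicGroupData.gl 2 K) φ) (glDiagonal 2 𝔸 ![a, 1]) *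
            ((IdeleClassGroup.ideleNorm K a : ℝ) : ℂ) ^ (s - 1 / 2)‖ₑ
          ∂(ν.map (Matrix.GeneralLinearGroup.det : GL (Fin 1) 𝔸 →* ideleGroup K)) < ∞ →
        jpssIntegral Nat.one_lt_two μ' φ (fun _ => 1) s =
          (C : ℂ) * ∫ a, whittakerDepth 0 (invQuot (AdelicGroupData.gl 2 K) φ) (glDiagonal 2 𝔸 ![a, 1]) *
            ((IdeleClassGroup.ideleNorm K a : ℝ) : ℂ) ^ (s - 1 / 2)
            ∂(ν.map (Matrix.GeneralLinearGroup.det : GL (Fin 1) 𝔸 →* ideleGroup K))) ∧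
        (∫⁻ a, ‖tildeFn (whittakerDepth 0 (invQuot (AdelicGroupData.gl 2 K) φ)) (glDiagonal 2 𝔸 ![a, 1]) *
            ((IdeleClassGroup.ideleNorm K a : ℝ) : ℂ) ^ (s - 1 / 2)‖ₑ
          ∂(ν.map (Matrix.GeneralLinearGroup.det : GL (Fin 1) 𝔸 →* ideleGroup K)) < ∞ →
        jpssIntegral Nat.one_lt_two μ' (φ ∘ glTransposeInvQuot 2 K) (fun _ => 1) s =
          (C : ℂ) * ∫ a, tildeFn (whittakerDepth 0 (invQuot (AdelicGroupData.gl 2 K) φ)) (glDiagonal 2 𝔸 ![a, 1]) *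
            ((IdeleClassGroup.ideleNorm K a : ℝ) : ℂ) ^ (s - 1 / 2)
            ∂(ν.map (Matrix.GeneralLinearGroup.det : GL (Fin 1) 𝔸 →* ideleGroup K))) := by
  classical
  obtain ⟨C, hC, hmain⟩ := exists_jpssIntegral_two_one_eq_mul_integral_idele (K := K) μ' ν
  refine ⟨C, hC, fun {hcpt} φ hφ s => ⟨hmain φ hφ s, fun hint => ?_⟩⟩
  haveI := isHaarMeasure_map_det_fin_one (K := K) ν
  set νI : Measure (ideleGroup K) := ν.map (Matrix.GeneralLinearGroup.det : GL (Fin 1) 𝔸 →* ideleGroup K) with hνI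
  set Φ : GL (Fin 2) 𝔸 → ℂ := invQuot (AdelicGroupData.gl 2 K) φ with hΦ
  -- the classical function of `φ ∘ ι̂` is the cusp form `Φ ∘ ι`
  have hcl : invQuot (AdelicGroupData.gl 2 K) (φ ∘ glTransposeInvQuot 2 K) = Φ ∘ GLn.transposeInv 2 K :=
    funext fun g => invQuot_comp_glTransposeInvQuot φ g
  have hφι : IsCuspFormGL 2 K hcpt (invQuot (AdelicGroupData.gl 2 K) (φ ∘ glTransposeInvQuot 2 K)) := by
    rw [hcl]; exact hφ.comp_transposeInv
  -- its Whittaker transform at `diag(a,1)` is `W̃_Φ(diag(-a,1))`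
  have hW : ∀ a : ideleGroup K,
      whittakerDepth 0 (invQuot (AdelicGroupData.gl 2 K) (φ ∘ glTransposeInvQuot 2 K)) (glDiagonal 2 𝔸 ![a, 1]) =
        tildeFn (whittakerDepth 0 Φ) (glDiagonal 2 𝔸 ![-a, 1]) := fun a => by
    rw [hcl]
    exact whittakerDepth_zero_comp_glTransposeInv_glDiagonal_two (φ := Φ) hφ.1.continuous_gl hφ.1.leftInvariant a
  -- the substitution `a ↦ -a = (-1) a` in the Haar integrals over `𝕀_K`
  set F : ideleGroup K → ℂ := fun a => tildeFn (whittakerDepth 0 Φ) (glDiagonal 2 𝔸 ![a, 1]) *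
    ((IdeleClassGroup.ideleNorm K a : ℝ) : ℂ) ^ (s - 1 / 2) with hF
  have hFneg : ∀ a : ideleGroup K,
      whittakerDepth 0 (invQuot (AdelicGroupData.gl 2 K) (φ ∘ glTransposeInvQuot 2 K)) (glDiagonal 2 𝔸 ![a, 1]) *
        ((IdeleClassGroup.ideleNorm K a : ℝ) : ℂ) ^ (s - 1 / 2) = F ((-1 : ideleGroup K) * a) := fun a => by
    simp only [hF]
    rw [hW a, neg_one_mul, ideleNorm_neg]
  have hlint : ∫⁻ a, ‖whittakerDepth 0 (invQuot (AdelicGroupData.gl 2 K) (φ ∘ glTransposeInvQuot 2 K))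
      (glDiagonal 2 𝔸 ![a, 1]) * ((IdeleClassGroup.ideleNorm K a : ℝ) : ℂ) ^ (s - 1 / 2)‖ₑ ∂νI < ∞ := by
    have h := lintegral_mul_left_eq_self (μ := νI) (fun a => ‖F a‖ₑ) (-1 : ideleGroup K)
    simp_rw [hFneg]
    rw [h]
    exact hint
  rw [(hmain (φ ∘ glTransposeInvQuot 2 K) hφι s hlint)]
  congr 1
  simp_rw [hFneg]
  exact integral_mul_left_eq_self (μ := νI) F (-1 : ideleGroup K)

end Main

end Literature.NumberTheory.Automorphic
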